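import Mathlib
import HarnessLib
import Summits.HubbardSuperconductivity.HubbardSuperconductivity.Theorems.KLProgrammeKLRegimeEnginePairTransferPPRateLoc

/-!
# Route `KLProgramme` — ENGINE item stmt-HubbardSuperconductivity-20437 `KLRegimeEngineV17F2`: PRODUCER-SIDE BRICK 5 — the in-class localisation-DIFFERENCE row `Rl₂`
# (member-`j′` rate × the DIFFERENCE of the two carriers' localisation brackets) from the kernel sup and ONE smearing number
# (cell gate-hubbard-kl, seat hubbard-kl-k3c2-p2 g29, technique «thermal-bar induction n ≤ nScales β + 1 with EngineBoundsAtV4S sums»)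

WHY.  Row 41 of KLTC-INDEX v10 (k3c1-p1's `pairTransferStep7_of_analytic_masses`) asks the (c) closer for four localisation rows: `RL₁ RL₂` (bricks 1–3, frame
`K_{n+1}`), `Rl₁` (the `D`-rung, bricks 4a/4b) and `Rl₂ : ‖Σ_z Br j′ Qm t z·(LOC-bracket(V_j t) − LOC-bracket(V_{j′} t))‖ ≤ Rl₂`, whose gain is NOT a frequency
localisation but the SMEARING difference of the two carriers (`‖V_j t X − V_{j′} t X‖ ≤ η`, k3c1's `klmd_kernelDiff4_le_binomial`, row 38).  Pointwise
`‖bracket(V₁) − bracket(V₂)‖ ≤ 𝟙ball·(η·Mv + Mv·η) + (η·Mv + Mv·η) ≤ 4ηMv` (`klmd_norm_mul_sub_mul_le_of_le`), so the TOTAL mass of brick 2 closes the row: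
* `klpr_norm_locBracket_sub_le` — the pointwise bound;
* **`klpr_locDiff_of_smearing`** — `‖Σ_z Br j′ Qm t z·(bracket(V₁) − bracket(V₂))‖ ≤ 2¹⁰·15367·(4·η·Mv)` for ANY `V₁ V₂` with sups `≤ Mv` and `‖V₁ X − V₂ X‖ ≤ η`
  (`FrameOK`, `klBetaMin ≤ β ≤ L`, `j′ ≥ n+1`; no ball data, no windows).
Real analysis over landed rows; nothing asserts (c), (X).3, K3 or superconductivity.  0 kit · 0 lit.
-/

noncomputable section

namespace Summit.HubbardSuperconductivity.HubbardSuperconductivity.Theorems.KLRegimeSplit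

set_option linter.dupNamespace false -- summit = problem name (single-conjunct summit), D-0017

open Real Set Finset Complex Literature.MathematicalPhysics.QuantumLattice
open Literature.Probability.LatticeModels hiding torusSupNorm
open Summit.HubbardSuperconductivity.HubbardSuperconductivity.Theorems.KLProgrammeLegKernels
open Summit.HubbardSuperconductivity.HubbardSuperconductivity.Theorems.KLRegimeWick
open Summit.HubbardSuperconductivity.HubbardSuperconductivity.Theorems.TwoPointAssembly
open Summit.HubbardSuperconductivity.HubbardSuperconductivity.Theorems.DispersionFlow
open Summit.HubbardSuperconductivity.HubbardSuperconductivity.Theorems.EngineV8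

variable {L M : ℕ} [NeZero L] [NeZero M] (β μ : ℝ) (K : TrigPolyC4v) {R : RenConsts} {U : ℝ} {N : ℕ}

/-- **Pointwise difference of two localisation brackets**: sups `‖V₁ X‖, ‖V₂ X‖ ≤ Mv`, smearing number `‖V₁ X − V₂ X‖ ≤ η` ⇒
`‖(𝟙·V₁(p₁)V₁(p₂) − V₁(r₁)V₁(r₂)) − (𝟙·V₂(p₁)V₂(p₂) − V₂(r₁)V₂(r₂))‖ ≤ 4·η·Mv`. -/
theorem klpr_norm_locBracket_sub_le (Qm x y : TorusSite 2 L) (V₁ V₂ : (Fin 4 → HubbardFieldIdx L M) → ℂ) {Mv η : ℝ}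
    (hM₁ : ∀ X, ‖V₁ X‖ ≤ Mv) (hM₂ : ∀ X, ‖V₂ X‖ ≤ Mv) (hη : ∀ X, ‖V₁ X - V₂ X‖ ≤ η) (z : TorusSite 2 L × MatsubaraIdx M) :
    ‖((if z.1 ∈ klBall L μ 0 then
          V₁ ![(((omega0 M, z.1), 0), 0), ((((omega0 M).rev, Qm - z.1), 1), 0), ((((omega0 M).rev, Qm - x), 1), 1), (((omega0 M, x), 0), 1)] *
            V₁ ![(((omega0 M, y), 0), 0), ((((omega0 M).rev, Qm - y), 1), 0), ((((omega0 M).rev, Qm - z.1), 1), 1), (((omega0 M, z.1), 0), 1)] else 0) -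
          V₁ ![(((z.2, z.1), 0), 0), (((z.2.rev, Qm - z.1), 1), 0), ((((omega0 M).rev, Qm - x), 1), 1), (((omega0 M, x), 0), 1)] *
            V₁ ![(((omega0 M, y), 0), 0), ((((omega0 M).rev, Qm - y), 1), 0), (((z.2.rev, Qm - z.1), 1), 1), (((z.2, z.1), 0), 1)]) -
        ((if z.1 ∈ klBall L μ 0 then
          V₂ ![(((omega0 M, z.1), 0), 0), ((((omega0 M).rev, Qm - z.1), 1), 0), ((((omega0 M).rev, Qm - x), 1), 1), (((omega0 M, x), 0), 1)] *
            V₂ ![(((omega0 M, y), 0), 0), ((((omega0 M).rev, Qm - y), 1), 0), ((((omega0 M).rev, Qm - z.1), 1), 1), (((omega0 M, z.1), 0), 1)] else 0) -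
          V₂ ![(((z.2, z.1), 0), 0), (((z.2.rev, Qm - z.1), 1), 0), ((((omega0 M).rev, Qm - x), 1), 1), (((omega0 M, x), 0), 1)] *
            V₂ ![(((omega0 M, y), 0), 0), ((((omega0 M).rev, Qm - y), 1), 0), (((z.2.rev, Qm - z.1), 1), 1), (((z.2, z.1), 0), 1)])‖ ≤ 4 * η * Mv := by
  have hM0 : 0 ≤ Mv := (norm_nonneg _).trans (hM₁ fun _ => (((omega0 M, x), 0), 0))
  have hη0 : 0 ≤ η := (norm_nonneg _).trans (hη fun _ => (((omega0 M, x), 0), 0))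
  have hprod : ∀ X Y, ‖V₁ X * V₁ Y - V₂ X * V₂ Y‖ ≤ η * Mv + Mv * η := fun X Y =>
    klmd_norm_mul_sub_mul_le_of_le (hη X) (hM₁ Y) (hM₂ X) (hη Y)
  have e : ∀ (a₁ b₁ a₂ b₂ : ℂ) (P : Prop) [Decidable P],
      ((if P then a₁ else 0) - b₁) - ((if P then a₂ else 0) - b₂) = (if P then a₁ - a₂ else 0) - (b₁ - b₂) := by
    intro a₁ b₁ a₂ b₂ P _; split_ifs <;> ring
  rw [e]
  refine (norm_sub_le _ _).trans ?_
  have h1 : ‖(if z.1 ∈ klBall L μ 0 then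
        V₁ ![(((omega0 M, z.1), 0), 0), ((((omega0 M).rev, Qm - z.1), 1), 0), ((((omega0 M).rev, Qm - x), 1), 1), (((omega0 M, x), 0), 1)] *
            V₁ ![(((omega0 M, y), 0), 0), ((((omega0 M).rev, Qm - y), 1), 0), ((((omega0 M).rev, Qm - z.1), 1), 1), (((omega0 M, z.1), 0), 1)] -
          V₂ ![(((omega0 M, z.1), 0), 0), ((((omega0 M).rev, Qm - z.1), 1), 0), ((((omega0 M).rev, Qm - x), 1), 1), (((omega0 M, x), 0), 1)] *
            V₂ ![(((omega0 M, y), 0), 0), ((((omega0 M).rev, Qm - y), 1), 0), ((((omega0 M).rev, Qm - z.1), 1), 1), (((omega0 M, z.1), 0), 1)] else 0)‖ ≤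
      η * Mv + Mv * η := by
    split_ifs
    · exact hprod _ _
    · rw [norm_zero]; positivity
  have h2 := hprod ![(((z.2, z.1), 0), 0), (((z.2.rev, Qm - z.1), 1), 0), ((((omega0 M).rev, Qm - x), 1), 1), (((omega0 M, x), 0), 1)]
    ![(((omega0 M, y), 0), 0), ((((omega0 M).rev, Qm - y), 1), 0), (((z.2.rev, Qm - z.1), 1), 1), (((z.2, z.1), 0), 1)]
  linarith

/-- **THE LOCALISATION-DIFFERENCE ROW `Rl₂` FROM THE SMEARING NUMBER.**  `FrameOK` frame `K`, `klBetaMin ≤ β ≤ L`, member `j′ ≥ n+1`, `t ∈ [0,1]`, θ's rate kernel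
`Br j′ Qm t` (verbatim lambdas); two carriers `V₁ V₂` with sups `≤ Mv` and `‖V₁ X − V₂ X‖ ≤ η` ⇒
`‖Σ_z Br j′ Qm t z·(bracket(V₁) − bracket(V₂))‖ ≤ 2¹⁰·15367·(4·η·Mv)` (pointwise `4ηMv` × the TOTAL mass of brick 2; no ball data, no windows). -/
theorem klpr_locDiff_of_smearing (hK : FrameOK R U N μ K) (hβ : klBetaMin ≤ β) (hβL : β ≤ L) (n : ℕ) {t : ℝ} (ht : t ∈ Icc (0 : ℝ) 1)
    (Φ : ℕ → ℝ → FreqMomentum L M → ℝ)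
    (hΦ : Φ = fun j t k => (softSymbolCompl L M β μ K (n + 1) j) k + (hubbardCutoffWeightCT L M β μ K (klScale klE0 (n + 1)) k -
        hubbardCutoffWeightCT L M β μ K (klScale klE0 n + t * (klScale klE0 (n + 1) - klScale klE0 n)) k))
    (Wd : ℝ → FreqMomentum L M → ℝ)
    (hWd : Wd = fun t k => deriv (fun Λ' : ℝ => hubbardCutoffWeightCT L M β μ K Λ' k) (klScale klE0 n + t * (klScale klE0 (n + 1) - klScale klE0 n)))
    (Br : ℕ → TorusSite 2 L → ℝ → TorusSite 2 L × MatsubaraIdx M → ℂ)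
    (hBr : Br = fun j Qm t z => -(((((β * (L : ℝ) ^ 2 : ℝ) : ℂ)))⁻¹ * propCT L M β μ K (z.2, z.1) * propCT L M β μ K (z.2.rev, Qm - z.1)) *
      ((((klScale klE0 (n + 1) - klScale klE0 n) * (-Wd t (z.2, z.1) * Φ j t (z.2.rev, Qm - z.1) - Φ j t (z.2, z.1) * Wd t (z.2.rev, Qm - z.1))) : ℝ) : ℂ))
    {j' : ℕ} (hj' : n + 1 ≤ j') (Qm x y : TorusSite 2 L) (V₁ V₂ : (Fin 4 → HubbardFieldIdx L M) → ℂ) {Mv η : ℝ}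
    (hM₁ : ∀ X, ‖V₁ X‖ ≤ Mv) (hM₂ : ∀ X, ‖V₂ X‖ ≤ Mv) (hη : ∀ X, ‖V₁ X - V₂ X‖ ≤ η) :
    ‖∑ z : TorusSite 2 L × MatsubaraIdx M, Br j' Qm t z *
        (((if z.1 ∈ klBall L μ 0 then
            V₁ ![(((omega0 M, z.1), 0), 0), ((((omega0 M).rev, Qm - z.1), 1), 0), ((((omega0 M).rev, Qm - x), 1), 1), (((omega0 M, x), 0), 1)] *
              V₁ ![(((omega0 M, y), 0), 0), ((((omega0 M).rev, Qm - y), 1), 0), ((((omega0 M).rev, Qm - z.1), 1), 1), (((omega0 M, z.1), 0), 1)] else 0) -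
            V₁ ![(((z.2, z.1), 0), 0), (((z.2.rev, Qm - z.1), 1), 0), ((((omega0 M).rev, Qm - x), 1), 1), (((omega0 M, x), 0), 1)] *
              V₁ ![(((omega0 M, y), 0), 0), ((((omega0 M).rev, Qm - y), 1), 0), (((z.2.rev, Qm - z.1), 1), 1), (((z.2, z.1), 0), 1)]) -
          ((if z.1 ∈ klBall L μ 0 then
            V₂ ![(((omega0 M, z.1), 0), 0), ((((omega0 M).rev, Qm - z.1), 1), 0), ((((omega0 M).rev, Qm - x), 1), 1), (((omega0 M, x), 0), 1)] *
              V₂ ![(((omega0 M, y), 0), 0), ((((omega0 M).rev, Qm - y), 1), 0), ((((omega0 M).rev, Qm - z.1), 1), 1), (((omega0 M, z.1), 0), 1)] else 0) -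
            V₂ ![(((z.2, z.1), 0), 0), (((z.2.rev, Qm - z.1), 1), 0), ((((omega0 M).rev, Qm - x), 1), 1), (((omega0 M, x), 0), 1)] *
              V₂ ![(((omega0 M, y), 0), 0), ((((omega0 M).rev, Qm - y), 1), 0), (((z.2.rev, Qm - z.1), 1), 1), (((z.2, z.1), 0), 1)]))‖ ≤
      (2 : ℝ) ^ 10 * 15367 * (4 * η * Mv) := by
  have hM0 : 0 ≤ Mv := (norm_nonneg _).trans (hM₁ fun _ => (((omega0 M, x), 0), 0))
  have hη0 : 0 ≤ η := (norm_nonneg _).trans (hη fun _ => (((omega0 M, x), 0), 0))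
  have hpt := klpr_norm_locBracket_sub_le μ Qm x y V₁ V₂ hM₁ hM₂ hη
  have htot := klpr_sum_norm_rate_le β μ K hK hβ hβL n ht Φ hΦ Wd hWd Br hBr hj' Qm
  refine (klmd_sum1_mul_le _ _ (fun _ => 4 * η * Mv) hpt).trans ?_
  rw [← Finset.sum_mul]
  calc (∑ z : TorusSite 2 L × MatsubaraIdx M, ‖Br j' Qm t z‖) * (4 * η * Mv) ≤ (2 : ℝ) ^ 10 * 15367 * (4 * η * Mv) :=
        mul_le_mul_of_nonneg_right htot (by positivity)
    _ = _ := rfl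

end Summit.HubbardSuperconductivity.HubbardSuperconductivity.Theorems.KLRegimeSplit

end
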